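import Mathlib.Analysis.SpecialFunctions.Pow.Deriv
import Mathlib.Analysis.Calculus.MeanValue
import HarnessLib

/-!
# The Euler equation of the orthogonality mode ([Elgindi2021] §7.1, Proposition 7.1 Step 1)

Topic `Literature/Analysis/FluidPDE`. Proof file (everything proved, no definitions, no named
facts) on the proof path of the named fact
`Literature.Analysis.FluidPDE.Elgindi.ElgindiGhoulMasmoudi2021_stabilityCore`
(`ElgindiStabilityDecomposition.lean`). T. M. Elgindi, Ann. of Math. 194 (2021) =
arXiv:1904.04795, §7.1 proof of Proposition 7.1, Step 1 (p. 19):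

> "Then, we see: `α²R²∂_RRΨ_⋆ + α(5+α)R∂_RΨ_⋆ = 0.` … This ODE for `Ψ_⋆` (an Euler equation!) can be
> solved explicitly … `Ψ_⋆(R) = c₁ + c₂R^{1−(5+α)/α}` and the condition that `Ψ_⋆ → 0` as `R → ∞` and
> that `R²Ψ` vanishes at `0` implies that `c₁ = c₂ = 0`. Therefore, `Ψ_⋆ ≡ 0`."

For the a-priori class used downstream (profiles compactly supported in `R ∈ (0, ∞)`), the
conclusion is: a `C²` function `y` on `ℝ` that vanishes for `R ≥ b` and solves
`α²R²y'' + α(5+α)Ry' = 0` on `R > 0` (`α > 0`) vanishes on `R > 0` (`eulerODE_eq_zero`). Proof as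
printed, through the first integral `R^{(5+α)/α}y'` (constant on `(0,∞)`, hence `0`).
-/

noncomputable section

open Set Real

namespace Literature.Analysis.FluidPDE

namespace Elgindi

/-- A function with zero derivative on `(0, ∞)` is constant there. [folklore] -/
theorem eq_of_deriv_eq_zero_Ioi {h : ℝ → ℝ} (hd : ∀ x ∈ Ioi (0 : ℝ), DifferentiableAt ℝ h x)
    (h0 : ∀ x ∈ Ioi (0 : ℝ), deriv h x = 0) {x y : ℝ} (hx : 0 < x) (hy : 0 < y) : h x = h y := by
  have := Convex.norm_image_sub_le_of_norm_deriv_le (C := 0) hd (fun z hz => by rw [h0 z hz]; simp)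
    (convex_Ioi 0) hx hy
  simp only [zero_mul, norm_le_zero_iff, sub_eq_zero] at this
  exact this.symm

/-- **The Euler equation has no nontrivial solution vanishing at infinity within the compactly
supported class**: if `y ∈ C²(ℝ)` vanishes for `R ≥ b`, `α > 0`, and
`α²R²y''(R) + α(5+α)Ry'(R) = 0` for all `R > 0`, then `y(R) = 0` for all `R > 0`. [cite: Elgindi2021, §7.1 proof of Proposition 7.1, Step 1 (p. 19 of arXiv:1904.04795)] -/
theorem eulerODE_eq_zero {y : ℝ → ℝ} (hy : ContDiff ℝ 2 y) {α b : ℝ} (hα : 0 < α)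
    (hb : ∀ R, b ≤ R → y R = 0)
    (hODE : ∀ R, 0 < R → α ^ 2 * R ^ 2 * deriv (deriv y) R + α * (5 + α) * R * deriv y R = 0) :
    ∀ R, 0 < R → y R = 0 := by
  have hd1 : Differentiable ℝ y := hy.differentiable (by simp)
  have hy1 : ContDiff ℝ 1 (deriv y) := by
    have := hy.iterate_deriv' 1 1
    simpa using this
  have hd2 : Differentiable ℝ (deriv y) := hy1.differentiable (by simp)
  -- `y' = 0` beyond `b ⊔ 1`
  set B : ℝ := max b 1 with hB
  have hBpos : 0 < B := lt_of_lt_of_le one_pos (le_max_right _ _)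
  have hyB : ∀ R, B < R → y R = 0 := fun R hR => hb R ((le_max_left _ _).trans hR.le)
  have hdyB : ∀ R, B < R → deriv y R = 0 := by
    intro R hR
    have : y =ᶠ[nhds R] fun _ => 0 :=
      Filter.eventuallyEq_of_mem (Ioi_mem_nhds hR) fun s hs => hyB s hs
    rw [this.deriv_eq, deriv_const]
  -- the first integral `h = R^k y'`, `k = (5+α)/α`
  set k : ℝ := (5 + α) / α with hk
  set h : ℝ → ℝ := fun R => R ^ k * deriv y R with hh
  have hder : ∀ R ∈ Ioi (0 : ℝ), HasDerivAt h 0 R := by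
    intro R hR
    have hR : 0 < R := hR
    have h1 : HasDerivAt (fun R : ℝ => R ^ k) (k * R ^ (k - 1)) R := Real.hasDerivAt_rpow_const (Or.inl hR.ne')
    have h2 : HasDerivAt (deriv y) (deriv (deriv y) R) R := (hd2 R).hasDerivAt
    have h3 := h1.mul h2
    refine h3.congr_deriv ?_
    have e := hODE R hR
    rw [Real.rpow_sub_one hR.ne' k]
    have hα2 : α ^ 2 * R ≠ 0 := by positivity
    have key : α ^ 2 * R * (k * (R ^ k / R) * deriv y R + R ^ k * deriv (deriv y) R) =
        R ^ k / R * (α ^ 2 * R ^ 2 * deriv (deriv y) R + α * (5 + α) * R * deriv y R) := by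
      rw [hk]
      field_simp
      ring
    rw [e, mul_zero] at key
    rcases mul_eq_zero.1 key with h' | h'
    · exact absurd h' hα2
    · simpa using h'
  have hdiff : ∀ R ∈ Ioi (0 : ℝ), DifferentiableAt ℝ h R := fun R hR => (hder R hR).differentiableAt
  have hderiv : ∀ R ∈ Ioi (0 : ℝ), deriv h R = 0 := fun R hR => (hder R hR).deriv
  have hh0 : ∀ R, 0 < R → h R = 0 := by
    intro R hR
    rw [eq_of_deriv_eq_zero_Ioi hdiff hderiv hR (by linarith : 0 < B + 1)]
    simp [hh, hdyB (B + 1) (by linarith)]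
  -- hence `y' = 0` on `(0, ∞)` and `y` is constant there, equal to `y(B+1) = 0`
  have hdy0 : ∀ R ∈ Ioi (0 : ℝ), deriv y R = 0 := by
    intro R hR
    have hR : 0 < R := hR
    have := hh0 R hR
    simp only [hh] at this
    rcases mul_eq_zero.1 this with h' | h'
    · exact absurd h' (Real.rpow_pos_of_pos hR k).ne'
    · exact h'
  intro R hR
  rw [eq_of_deriv_eq_zero_Ioi (fun R _ => (hd1 R)) hdy0 hR (by linarith : 0 < B + 1)]
  exact hyB (B + 1) (by linarith)

end Elgindi

end Literature.Analysis.FluidPDE
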